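import Summits.Parity.GeneralizedHardyLittlewood.Theorems.FordMaynardSieveConst01651SieveConst01651Dim5Check
import Mathlib.Tactic.IntervalCases
import HarnessLib

/-!
# Route `FordMaynardSieveConst01651`, target `SieveConst01651` (stmt-Parity-19185), stub `stub_coneCertClosed`,
# residue `h5`: enumeration soundness of the dimension-5 type checker (combinatorial part)

Def-free helper file.  `dim5Check = true` is a statement about a pruned enumeration; here we extract from it the
verdict `typeOK … = true` for ANY single type `(a, b)` satisfying the hypotheses a real point of `ℋ₅` produces
(`typeOK_of_dim5Check`): cells monotone and `≤ 73`, R1 (`∑ e_{aᵢ} < 1 < ∑ e_{aᵢ+1}` in units of `1/120000`), every band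
allowed by rule R2/S (`bandAllowed`), bands monotone (rule M).  Ingredients: membership in the `upWhile` loops
(`mem_upWhile`, using that the prefix tests are monotone in the loop variable via `edgeNum_mono`) and `List.all`.
No real numbers appear in this file.

References: [FordMaynard2024PrimeSieves] arXiv:2407.14368, §8.2.
-/

namespace Summit.Parity.GeneralizedHardyLittlewood.FordMaynardSieveConst01651SieveConst01651

/-- `edgeNum` is monotone. [folklore] -/
theorem edgeNum_mono {a b : ℕ} (h : a ≤ b) : edgeNum a ≤ edgeNum b := by
  unfold edgeNum
  split_ifs <;> omega

/-- Membership in an ascending-while loop: if `p` holds on `[s, y]` and `y < s + n` then `y` is visited. [folklore] -/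
theorem mem_upWhile {p : ℕ → Bool} {n : ℕ} :
    ∀ {s y : ℕ}, s ≤ y → y < s + n → (∀ z, s ≤ z → z ≤ y → p z = true) → y ∈ upWhile p s n := by
  induction n with
  | zero => intro s y h1 h2 _; omega
  | succ n ih =>
      intro s y h1 h2 hp
      have hps : p s = true := hp s le_rfl h1
      have hdef : upWhile p s (n + 1) = (if p s then s :: upWhile p (s + 1) n else []) := rfl
      rw [hdef, if_pos hps]
      rcases Nat.eq_or_lt_of_le h1 with h | hlt
      · rw [h]; exact List.mem_cons_self
      · exact List.mem_cons_of_mem _ (ih hlt (by omega) (fun z hz hzy => hp z (by omega) hzy))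

/-- An allowed band `j ≤ 2` is listed by `bandsOf`. [folklore] -/
theorem mem_bandsOf {lo hi clo chi j : ℕ} (hj : j ≤ 2) (h : bandAllowed lo hi clo chi j = true) :
    j ∈ bandsOf lo hi clo chi := by
  unfold bandsOf
  rw [List.mem_filter]
  refine ⟨?_, h⟩
  interval_cases j <;> simp

/-- From `l.all f = true` and `y ∈ l`: `f y = true`. [folklore] -/
theorem all_mem {α : Type*} {l : List α} {f : α → Bool} (h : l.all f = true) {y : α} (hy : y ∈ l) : f y = true :=
  List.all_eq_true.1 h y hy

/-- **Enumeration soundness.** `dim5Check = true` yields `typeOK` for every type with monotone cells `≤ 73` satisfying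
R1, with all ten bands allowed (R2/S) and monotone (M). [folklore] -/
theorem typeOK_of_dim5Check (h : dim5Check = true) (a0 a1 a2 a3 a4 b01 b02 b03 b04 b12 b13 b14 b23 b24 b34 : ℕ)
    (h01 : a0 ≤ a1) (h12 : a1 ≤ a2) (h23 : a2 ≤ a3) (h34 : a3 ≤ a4) (h74 : a4 < 74)
    (hR1 : edgeNum a0 + edgeNum a1 + edgeNum a2 + edgeNum a3 + edgeNum a4 < 120000)
    (hR1' : 120000 < edgeNum (a0 + 1) + edgeNum (a1 + 1) + edgeNum (a2 + 1) + edgeNum (a3 + 1) + edgeNum (a4 + 1))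
    (hb01 : bandAllowed (edgeNum a0 + edgeNum a1) (edgeNum (a0 + 1) + edgeNum (a1 + 1))
      (edgeNum a2 + edgeNum a3 + edgeNum a4) (edgeNum (a2 + 1) + edgeNum (a3 + 1) + edgeNum (a4 + 1)) b01 = true)
    (hb02 : bandAllowed (edgeNum a0 + edgeNum a2) (edgeNum (a0 + 1) + edgeNum (a2 + 1))
      (edgeNum a1 + edgeNum a3 + edgeNum a4) (edgeNum (a1 + 1) + edgeNum (a3 + 1) + edgeNum (a4 + 1)) b02 = true)
    (hb03 : bandAllowed (edgeNum a0 + edgeNum a3) (edgeNum (a0 + 1) + edgeNum (a3 + 1))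
      (edgeNum a1 + edgeNum a2 + edgeNum a4) (edgeNum (a1 + 1) + edgeNum (a2 + 1) + edgeNum (a4 + 1)) b03 = true)
    (hb04 : bandAllowed (edgeNum a0 + edgeNum a4) (edgeNum (a0 + 1) + edgeNum (a4 + 1))
      (edgeNum a1 + edgeNum a2 + edgeNum a3) (edgeNum (a1 + 1) + edgeNum (a2 + 1) + edgeNum (a3 + 1)) b04 = true)
    (hb12 : bandAllowed (edgeNum a1 + edgeNum a2) (edgeNum (a1 + 1) + edgeNum (a2 + 1))
      (edgeNum a0 + edgeNum a3 + edgeNum a4) (edgeNum (a0 + 1) + edgeNum (a3 + 1) + edgeNum (a4 + 1)) b12 = true)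
    (hb13 : bandAllowed (edgeNum a1 + edgeNum a3) (edgeNum (a1 + 1) + edgeNum (a3 + 1))
      (edgeNum a0 + edgeNum a2 + edgeNum a4) (edgeNum (a0 + 1) + edgeNum (a2 + 1) + edgeNum (a4 + 1)) b13 = true)
    (hb14 : bandAllowed (edgeNum a1 + edgeNum a4) (edgeNum (a1 + 1) + edgeNum (a4 + 1))
      (edgeNum a0 + edgeNum a2 + edgeNum a3) (edgeNum (a0 + 1) + edgeNum (a2 + 1) + edgeNum (a3 + 1)) b14 = true)
    (hb23 : bandAllowed (edgeNum a2 + edgeNum a3) (edgeNum (a2 + 1) + edgeNum (a3 + 1))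
      (edgeNum a0 + edgeNum a1 + edgeNum a4) (edgeNum (a0 + 1) + edgeNum (a1 + 1) + edgeNum (a4 + 1)) b23 = true)
    (hb24 : bandAllowed (edgeNum a2 + edgeNum a4) (edgeNum (a2 + 1) + edgeNum (a4 + 1))
      (edgeNum a0 + edgeNum a1 + edgeNum a3) (edgeNum (a0 + 1) + edgeNum (a1 + 1) + edgeNum (a3 + 1)) b24 = true)
    (hb34 : bandAllowed (edgeNum a3 + edgeNum a4) (edgeNum (a3 + 1) + edgeNum (a4 + 1))
      (edgeNum a0 + edgeNum a1 + edgeNum a2) (edgeNum (a0 + 1) + edgeNum (a1 + 1) + edgeNum (a2 + 1)) b34 = true)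
    (hj : b01 ≤ 2 ∧ b02 ≤ 2 ∧ b03 ≤ 2 ∧ b04 ≤ 2 ∧ b12 ≤ 2 ∧ b13 ≤ 2 ∧ b14 ≤ 2 ∧ b23 ≤ 2 ∧ b24 ≤ 2 ∧ b34 ≤ 2)
    (hM : bandsMonotone b01 b02 b03 b04 b12 b13 b14 b23 b24 b34 = true) :
    typeOK a0 a1 a2 a3 a4 b01 b02 b03 b04 b12 b13 b14 b23 b24 b34 = true := by
  obtain ⟨j01, j02, j03, j04, j12, j13, j14, j23, j24, j34⟩ := hj
  have m01 := edgeNum_mono h01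
  have m12 := edgeNum_mono h12
  have m23 := edgeNum_mono h23
  have m34 := edgeNum_mono h34
  -- level 0
  have hA0 : a0 ∈ upWhile (fun a0 => decide (5 * edgeNum a0 < 120000)) 0 74 :=
    mem_upWhile (Nat.zero_le _) (by omega) fun z _ hz => by
      have := edgeNum_mono hz
      exact decide_eq_true (by omega)
  have h0 := all_mem h hA0
  unfold dim5CheckFrom at h0
  -- level 1
  have hA1 : a1 ∈ upWhile (fun a1 => decide (edgeNum a0 + 4 * edgeNum a1 < 120000)) a0 (74 - a0) :=
    mem_upWhile h01 (by omega) fun z _ hz => by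
      have := edgeNum_mono hz
      exact decide_eq_true (by omega)
  have h1 := all_mem h0 hA1
  -- level 2
  have hA2 : a2 ∈ upWhile (fun a2 => decide (edgeNum a0 + edgeNum a1 + 3 * edgeNum a2 < 120000)) a1 (74 - a1) :=
    mem_upWhile h12 (by omega) fun z _ hz => by
      have := edgeNum_mono hz
      exact decide_eq_true (by omega)
  have h2 := all_mem h1 hA2
  -- level 3
  have hA3 : a3 ∈ upWhile (fun a3 => decide (edgeNum a0 + edgeNum a1 + edgeNum a2 + 2 * edgeNum a3 < 120000))
      a2 (74 - a2) :=
    mem_upWhile h23 (by omega) fun z _ hz => by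
      have := edgeNum_mono hz
      exact decide_eq_true (by omega)
  have h3 := all_mem h2 hA3
  -- level 4
  have hA4 : a4 ∈ upWhile
      (fun a4 => decide (edgeNum a0 + edgeNum a1 + edgeNum a2 + edgeNum a3 + edgeNum a4 < 120000)) a3 (74 - a3) :=
    mem_upWhile h34 (by omega) fun z _ hz => by
      have := edgeNum_mono hz
      exact decide_eq_true (by omega)
  have h4 := all_mem h3 hA4
  -- R1 upper, then the cell vector
  have hup : r1Upper a0 a1 a2 a3 a4 = true := by
    unfold r1Upper; exact decide_eq_true hR1'
  simp only [hup, Bool.not_true, Bool.false_or] at h4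
  unfold cellVecOK at h4
  simp only at h4
  have h5 := all_mem h4 (mem_bandsOf j01 hb01)
  have h6 := all_mem h5 (mem_bandsOf j02 hb02)
  have h7 := all_mem h6 (mem_bandsOf j03 hb03)
  have h8 := all_mem h7 (mem_bandsOf j04 hb04)
  have h9 := all_mem h8 (mem_bandsOf j12 hb12)
  have h10 := all_mem h9 (mem_bandsOf j13 hb13)
  have h11 := all_mem h10 (mem_bandsOf j14 hb14)
  have h12' := all_mem h11 (mem_bandsOf j23 hb23)
  have h13 := all_mem h12' (mem_bandsOf j24 hb24)
  have h14 := all_mem h13 (mem_bandsOf j34 hb34)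
  simpa [hM] using h14

end Summit.Parity.GeneralizedHardyLittlewood.FordMaynardSieveConst01651SieveConst01651
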